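import Literature.AnabelianGeometry.EtaleTheta.Discharge.Sec5Lem59iiOfConnectedTemperoidData

/-!
# [EtTh] Lemma 5.9 (i) ⟺ Prop. 4.3 (iii) under the section properties; Lemma 5.9 (i) over the MODEL setting; print-orientation Prop. 4.3 (iii) at the genuine §5 data

Mochizuki, *The étale theta function and its Frobenioid-theoretic manifestations*, Publ. RIMS **45** (2009),
Lemma 5.9 (i), printed p. 331 (PDF p. 105 of `paper:doi-10-2977-prims-1234361159`, read on the page):
"`s^⊓-gp_N|_{H_{B_N}}`, `s^⊔-gp_N` factor through `E_N`" — where (p. 331, ll. 31–36)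
"`E_N := s^⊓-gp_N(Im(Π^tp_Y)) · μ_N(B_N) ⊆ Aut_C(B_N)`"; proof (p. 332): "Immediate from the definitions"
[cf. Prop. 4.3 (iii): "the difference `s^⊓-gp_N · (s^⊔-gp_N)^{-1}` determines a twisted homomorphism
`H_{B_N} → μ_N(B_N)`", p. 317 (PDF p. 91)].
[cite: MochizukiEtTh2009, Lem 5.9 (i) p.331 (PDF p.105); Prop 4.3 (iii) p.317 (PDF p.91)]

abc-iut cell, cone node `EtTh:Lem5.9(i)` (kernel index `Summit.ABC.IUTFork.DAG.N_EtTh_Lem5_9_i`), seat abc-iut-w6-d053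
(W6 tranche 2, row d053).  PROOF-ONLY companion (no definitions, no instances, no new `Prop` facts) of the landed files it
imports; nothing landed is edited or restated.  COMPLEMENT of abc-iut-w6-d054's `Sec5Lem59iiOfConnectedTemperoidData.lean`
(p433353), which proves Prop. 4.3 (iii) / Lemma 5.9 (i) / (ii) over the genuine connected base `B^temp(Π^tp_X)⁰`
(`…_ofConnectedTemperoidData`, mod `hH`) and with NO named input for `A_⊙^bs := Ÿ` (`…_ofConnectedTemperoidYddData`) —
those theorems are CONSUMED here by name, not re-derived.

State of the node in the tree (all BY NAME): the typed clause `ThetaFrobenioid.SectionsFactor 𝔉` (FACT-LIST F-0542;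
abc-iut-L2-t4, `FrobenioidMonoTheta.lean`, p407021) is PROVED for every §5 datum `𝔉` modulo Prop. 4.3 (iii)
`BiKummerDifferenceMem` (F-0551): `sectionsFactor_of (hdiff)`; at the assembled data `ofBiKummerData` Prop. 4.3 (iii) is
`biKummerDifferenceMem_ofBiKummerData` (p418152) modulo `hσ`, `hH`, `hfrac`, `haut`; over `B^temp(Π^tp_X)⁰` see p433353.

WHAT THIS FILE ADDS.
* GENERIC (every `𝔉`): the first half "`s^⊓-gp_N|_{H_{B_N}}` factors through `E_N`" is UNCONDITIONAL
  (`sgpCap_coe_mem_EN`, since `H_{B_N} ⊆ Im(Π^tp_Y̲)`), so `SectionsFactor ↔ ∀ h, s^⊔-gp_N(h) ∈ E_N`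
  (`sectionsFactor_iff_sgpCup_mem_EN`); and the CONVERSE of `sectionsFactor_of`: once both `s^⊓-gp_N`, `s^⊔-gp_N` are
  sections over `H_{B_N}`, Lemma 5.9 (i) IMPLIES Prop. 4.3 (iii) (`biKummerDifferenceMem_of_sectionsFactor`: the
  difference lies in `E_N ∩ Ker(Aut_C(B_N) → Aut_D(B_N^bs)) = μ_N(B_N)`, the kernel clause of Lemma 5.9 (ii) `enExact_of`),
  whence `sectionsFactor_iff_biKummerDifferenceMem` — clause (i) carries EXACTLY the content of the bi-Kummer cocycle fact;
  element form `exists_sgpCup_eq_muTorsion_mul_sgpCap` (`s^⊔-gp_N(h) = ζ · s^⊓-gp_N(h)`, `ζ ∈ μ_N(B_N)`);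
* MODEL SETTING (abc-iut-L2-t9's `BiKummerSetting.mkOfModel` over an ARBITRARY base `D`, dictionary `toB := id`): the laws
  `hfrac` / `haut` are abc-iut-L6-t12's theorems `coe_fracOfModel_mul_unit` / `coe_biratAutModel_eq_pull`
  (`Discharge/Sec4Model.lean`), exactly as in abc-iut-L2-t4's `facts_ofModelData` — `biKummerDifferenceMem_ofModelData`,
  `sectionsFactor_ofModelData` (mod `hσ`, `hH` only; the form the `ofSetting` junction and any non-connected base consume);
* GENUINE CONNECTED BASE (abc-iut-L2-t4's `ofConnectedTemperoidData`, p427614): both sections ARE sections over `H_{B_N}`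
  outright (`sgpCapSection_ofConnectedTemperoidData`; `sgpCupSection_ofBiKummerData` with `hσ := baseMap_strvOfBiKummerData`),
  hence the unconditional equivalence `sectionsFactor_iff_biKummerDifferenceMem_ofConnectedTemperoidData`; the second-half
  clause `sgpCup_mem_EN_ofConnectedTemperoidData` and Prop. 4.3 (iii) in PRINT's orientation
  `sgpCap_mul_sgpCup_inv_mem_muTorsion_ofConnectedTemperoidData` (mod `hH`; abc-iut-f-125's
  `sgpCap_mul_sgpCup_inv_mem_muTorsion_ofBiKummerData` needed four binders);
* `A_⊙^bs := Ÿ` (`mkOfConnectedTemperoidYdd`, `hH` = theorem `hH_mkOfConnectedTemperoidYdd`): print-orientation Prop. 4.3 (iii)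
  with NO named input (`sgpCap_mul_sgpCup_inv_mem_muTorsion_ofConnectedTemperoidYddData`) and the node package
  `prop43iii_and_lem59i_ofConnectedTemperoidYddData` (= p433353's two theorems conjoined, for the CERT-L2 conjunct shape).
HONEST FRAMING: [EtTh] is refereed; kernel-checked implications over the cell's typed §3–§5 data structures, whose parameter
class `TemperedFrobenioid T₀ (ConnectedPart (BTemp X.Pi)) VD` is not shown inhabited here; nothing here bears on
[IUTchIII] Cor. 3.12 or takes a side on any author; typed ≠ proved for data not of this form.
-/

noncomputable section

namespace Literature.AnabelianGeometry.EtaleTheta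

open CategoryTheory Opposite Literature.AlgebraicGeometry.Frobenioids Literature.AnabelianGeometry.SemiGraphs
  Literature.AnabelianGeometry.SemiGraphs.GaloisObjects Literature.AlgebraicGeometry.Frobenioids.QuasiTemperoid.BTempConnected

namespace ThetaFrobenioid

universe u₀ v₀ u v w w' v' u' u''

/-! ### Generic: the logical position of clause (i) for every §5 datum -/

section Generic

variable {C : Type u'} [Category.{v'} C] {D : Type u''} [Category.{w'} D] (𝔉 : ThetaFrobenioid.{w} C D)

/-- **First half of Lemma 5.9 (i), UNCONDITIONAL**: `s^⊓-gp_N(h) ∈ E_N` for every `h ∈ H_{B_N}` — because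
`H_{B_N} ⊆ Im(Π^tp_Y̲)` (`Π^tp_Ÿ̲ ⊆ Π^tp_Y̲`) and `E_N ⊇ s^⊓-gp_N(Im(Π^tp_Y̲))` by definition (p. 331 (PDF p. 105)).
[cite: MochizukiEtTh2009, Lem 5.9 (i) p.331 (PDF p.105)] -/
theorem sgpCap_coe_mem_EN (hh : 𝔉.HB) : 𝔉.sgpCap (hh : Aut (𝔉.base.obj 𝔉.BN)) ∈ 𝔉.EN :=
  section_mem_sectionSubgroup 𝔉.sgpCap 𝔉.imPiY _ (𝔉.HB_le_imPiY hh.2)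

/-- Lemma 5.9 (i) as typed is equivalent to its SECOND half "`s^⊔-gp_N` factors through `E_N`" (the first half being
unconditional, `sgpCap_coe_mem_EN`). [cite: MochizukiEtTh2009, Lem 5.9 (i) p.331 (PDF p.105)] -/
theorem sectionsFactor_iff_sgpCup_mem_EN : 𝔉.SectionsFactor ↔ ∀ hh : 𝔉.HB, 𝔉.sgpCup hh ∈ 𝔉.EN :=
  ⟨fun h1 => h1.2, fun h2 => ⟨𝔉.sgpCap_coe_mem_EN, h2⟩⟩

/-- **Lemma 5.9 (i) ⟹ Prop. 4.3 (iii)** once `s^⊓-gp_N` and `s^⊔-gp_N` are sections over `H_{B_N}`: if both sections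
factor through `E_N`, their difference `s^⊔-gp_N(h) · s^⊓-gp_N(h)⁻¹` lies in `E_N` and in
`Ker(Aut_C(B_N) → Aut_D(B_N^bs))` (`sgpCup_mul_sgpCap_inv_mem_units`, `O^×(B_N) = Ker`), hence in
`E_N ∩ Ker = μ_N(B_N)` — the kernel clause of Lemma 5.9 (ii) (`enExact_of`).
[cite: MochizukiEtTh2009, Prop 4.3 (iii) p.317 (PDF p.91); Lem 5.9 (i)(ii) p.331–332 (PDF pp.105–106)] -/
theorem biKummerDifferenceMem_of_sectionsFactor (hsec : 𝔉.SgpCapSection) (hcs : 𝔉.SgpCupSection)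
    (h1 : 𝔉.SectionsFactor) : 𝔉.BiKummerDifferenceMem := by
  intro hh
  have hEN : 𝔉.sgpCup hh * (𝔉.sgpCap (hh : Aut (𝔉.base.obj 𝔉.BN)))⁻¹ ∈ 𝔉.EN :=
    𝔉.EN.mul_mem (h1.2 hh) (𝔉.EN.inv_mem (h1.1 hh))
  have hker : 𝔉.sgpCup hh * (𝔉.sgpCap (hh : Aut (𝔉.base.obj 𝔉.BN)))⁻¹ ∈ (𝔉.autBase 𝔉.BN).ker := by
    rw [← units_eq_ker]
    exact 𝔉.sgpCup_mul_sgpCap_inv_mem_units hsec hcs hh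
  have hinf : 𝔉.sgpCup hh * (𝔉.sgpCap (hh : Aut (𝔉.base.obj 𝔉.BN)))⁻¹ ∈ 𝔉.EN ⊓ (𝔉.autBase 𝔉.BN).ker :=
    Subgroup.mem_inf.mpr ⟨hEN, hker⟩
  rwa [(𝔉.enExact_of hsec).2] at hinf

/-- **Lemma 5.9 (i) ⟺ Prop. 4.3 (iii)** for a §5 datum both of whose sections `s^⊓-gp_N`, `s^⊔-gp_N` lie over `H_{B_N}`
(`sectionsFactor_of` / `biKummerDifferenceMem_of_sectionsFactor`): clause (i) carries exactly the content of the
bi-Kummer cocycle fact. [cite: MochizukiEtTh2009, Lem 5.9 (i) p.331 (PDF p.105); Prop 4.3 (iii) p.317 (PDF p.91)] -/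
theorem sectionsFactor_iff_biKummerDifferenceMem (hsec : 𝔉.SgpCapSection) (hcs : 𝔉.SgpCupSection) :
    𝔉.SectionsFactor ↔ 𝔉.BiKummerDifferenceMem :=
  ⟨𝔉.biKummerDifferenceMem_of_sectionsFactor hsec hcs, 𝔉.sectionsFactor_of⟩

/-- Under Prop. 4.3 (iii), the second section's value at `h ∈ H_{B_N}` is the first section's value times a cyclotomic
unit ON THE LEFT: `s^⊔-gp_N(h) = ζ · s^⊓-gp_N(h)` with `ζ ∈ μ_N(B_N)` — the element-level reading of "factor through
`E_N = s^⊓-gp_N(Im(Π^tp_Y)) · μ_N(B_N)`". [cite: MochizukiEtTh2009, Lem 5.9 (i) p.331 (PDF p.105)] -/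
theorem exists_sgpCup_eq_muTorsion_mul_sgpCap (hdiff : 𝔉.BiKummerDifferenceMem) (hh : 𝔉.HB) :
    ∃ ζ ∈ 𝔉.muTorsion 𝔉.BN 𝔉.N, 𝔉.sgpCup hh = ζ * 𝔉.sgpCap (hh : Aut (𝔉.base.obj 𝔉.BN)) :=
  ⟨𝔉.sgpCup hh * (𝔉.sgpCap (hh : Aut (𝔉.base.obj 𝔉.BN)))⁻¹, hdiff hh, by rw [inv_mul_cancel_right]⟩

end Generic

/-! ### Lemma 5.9 (i) for the §5 data assembled over the MODEL setting (dictionary = identity), modulo `hσ`, `hH` -/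

section Model

variable {K : Type u₀} [Field K] {X : SemiGraphs.TemperedArithmeticGroup.{u₀} K} {D₀ : Type u₀} [Category.{v₀} D₀]
  {V : FrdIMonoidStub.{w}} {T₀ : RealifiedDivisorMonoids (D₀ := D₀) V} {D : Type u} [Category.{v} D]
  {VD : FrdICatStub.{u, v, w} D} {tf : TemperedFrobenioid T₀ D VD} {hZ : tf.monoidType = MonoidType.Z}
  {hP : ∀ A : Dᵒᵖ, IsPerfect (tf.Φ.carrier A)} {hBΛ : ∀ (Y : D₀ᵒᵖ) (b : T₀.BΛ.obj Y), IsUnit b}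
  {DS : ∀ {A : Dᵒᵖ}, tf.Φ.carrier A → tf.Φ.carrier A → Prop} {IG : D → Prop}
  {gS : ∀ A : D, IG A → (X.Pi →* Aut A)} {gSs : ∀ (A : D) (h : IG A), Function.Surjective (gS A h)}
  {NH : Subgroup (Field.absoluteGaloisGroup K) → tf.category → ℕ+ → Prop}
  {AB : ∀ {A B : tf.category}, Subgroup (Aut A) → (A ⟶ A) → (A ⟶ B) → Prop} {A₀ : tf.category}
  {hA₀ : PreFrobenioid.IsFrobeniusTrivial tf.toElem A₀} {hA₀' : IG A₀.base}
  {pullFrac : ∀ {A A' : (BiKummerSetting.mkOfModel X tf hZ hP hBΛ DS IG gS gSs NH AB A₀ hA₀ hA₀').C} (_ : A' ⟶ A),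
    (BiKummerSetting.mkOfModel X tf hZ hP hBΛ DS IG gS gSs NH AB A₀ hA₀ hA₀').biratUnits A →
      (BiKummerSetting.mkOfModel X tf hZ hP hBΛ DS IG gS gSs NH AB A₀ hA₀ hA₀').biratUnits A'}
  {lv N : ℕ+} {T : ThetaEnvData.{max v w} N}
  {θ : (BiKummerSetting.mkOfModel X tf hZ hP hBΛ DS IG gS gSs NH AB A₀ hA₀ hA₀').biratUnits
    (BiKummerSetting.mkOfModel X tf hZ hP hBΛ DS IG gS gSs NH AB A₀ hA₀ hA₀').Aodot}
  {Bl : (BiKummerSetting.mkOfModel X tf hZ hP hBΛ DS IG gS gSs NH AB A₀ hA₀ hA₀').C}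
  {Pl : (BiKummerSetting.mkOfModel X tf hZ hP hBΛ DS IG gS gSs NH AB A₀ hA₀ hA₀').FractionPair θ Bl}
  {Rl : (BiKummerSetting.mkOfModel X tf hZ hP hBΛ DS IG gS gSs NH AB A₀ hA₀ hA₀').NthRoot θ Pl lv pullFrac}
  (h : ModelFrobenioid.Hypotheses tf.divisorMonoid tf.ratFnFunctor) (Q : FrobenioidTheta.ThetaSubquotientStub.{w} D)
  (odd_l : Odd (lv : ℕ))
  (R : (BiKummerSetting.mkOfModel X tf hZ hP hBΛ DS IG gS gSs NH AB A₀ hA₀ hA₀').NthRoot Rl.root Rl.pair N pullFrac)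
  (ιX : T.PiX ≃ₜ* X.Pi)
  (hopen : IsOpen (((BiKummerSetting.mkOfModel X tf hZ hP hBΛ DS IG gS gSs NH AB A₀ hA₀ hA₀').galoisSurj R.AN.base
    R.αData.isGalois).ker : Set X.Pi))
  (σ : Aut R.AN.base →* Aut R.AN) (K' : Type w) [Field K']
  (constEmb : K'ˣ →* (BiKummerSetting.mkOfModel X tf hZ hP hBΛ DS IG gS gSs NH AB A₀ hA₀ hA₀').tf.biratUnitsModel R.BN)
  (constEmb_injective : Function.Injective constEmb)
  (hdivc : ∀ g : Aut R.BN.base,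
    ModelFrobenioid.div ((σ ((BiKummerSetting.NthRoot.baseIso
      (BiKummerSetting.mkOfModel X tf hZ hP hBΛ DS IG gS gSs NH AB A₀ hA₀ hA₀') R).conjAut.symm g)).hom ≫ R.pair.num) =
      ModelFrobenioid.div R.pair.num)
  (hdivp : ∀ y : T.PiYdd,
    ModelFrobenioid.div ((σ ((BiKummerSetting.mkOfModel X tf hZ hP hBΛ DS IG gS gSs NH AB A₀ hA₀ hA₀').galoisSurj R.AN.base
      R.αData.isGalois (ιX y.1))).hom ≫ R.pair.den) = ModelFrobenioid.div R.pair.den)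

/-- **Prop. 4.3 (iii) `BiKummerDifferenceMem` for the §5 data assembled over the MODEL setting** (birational units
`O^×(A^birat) := B(A_D)^×`, dictionary `toB := id`): from the section property `hσ` of `σ = s^trv_N` ([FrdI] Prop. 5.6) and
`hH` (`Π^tp_Ÿ ⊆ H_⊙`, p. 322 (PDF p. 96)) ALONE — the [FrdI] Thm. 5.2 (ii) dictionary laws being abc-iut-L6-t12's theorems
`coe_fracOfModel_mul_unit` / `coe_biratAutModel_eq_pull`, composed with abc-iut-L2-t4's `biKummerDifferenceMem_ofBiKummerData`.
[cite: MochizukiEtTh2009, Prop 4.3 (iii) p.317 (PDF p.91); §5 p.331 (PDF p.105)] -/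
theorem biKummerDifferenceMem_ofModelData (hσ : ∀ g : Aut R.AN.base, ModelFrobenioid.baseMap (σ g).hom = g.hom)
    (hH : ∀ y : T.PiX, y ∈ T.PiYdd →
      ιX y ∈ (BiKummerSetting.mkOfModel X tf hZ hP hBΛ DS IG gS gSs NH AB A₀ hA₀ hA₀').Hodot) :
    (ofBiKummerData h (fun _ => MonoidHom.id _) Q odd_l R ιX hopen σ K' constEmb
      constEmb_injective hdivc hdivp).BiKummerDifferenceMem :=
  biKummerDifferenceMem_ofBiKummerData h _ Q odd_l R ιX hopen σ K' constEmb constEmb_injective hdivc hdivp hσ hH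
    (fun s' s'' _ _ _ => BiKummerSetting.coe_fracOfModel_mul_unit tf hBΛ s' s'')
    (fun e x => BiKummerSetting.coe_biratAutModel_eq_pull tf e x)

/-- **[EtTh] Lemma 5.9 (i) for the §5 data assembled over the MODEL setting**: `s^⊓-gp_N|_{H_{B_N}}`, `s^⊔-gp_N` factor
through `E_N`, modulo `hσ` ([FrdI] Prop. 5.6) and `hH` (p. 322) — by `sectionsFactor_of` and `biKummerDifferenceMem_ofModelData`.
[cite: MochizukiEtTh2009, Lem 5.9 (i) p.331 (PDF p.105)] -/
theorem sectionsFactor_ofModelData (hσ : ∀ g : Aut R.AN.base, ModelFrobenioid.baseMap (σ g).hom = g.hom)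
    (hH : ∀ y : T.PiX, y ∈ T.PiYdd →
      ιX y ∈ (BiKummerSetting.mkOfModel X tf hZ hP hBΛ DS IG gS gSs NH AB A₀ hA₀ hA₀').Hodot) :
    (ofBiKummerData h (fun _ => MonoidHom.id _) Q odd_l R ιX hopen σ K' constEmb
      constEmb_injective hdivc hdivp).SectionsFactor :=
  sectionsFactor_of _ (biKummerDifferenceMem_ofModelData h Q odd_l R ιX hopen σ K' constEmb constEmb_injective hdivc hdivp
    hσ hH)

end Model

/-! ### Over the GENUINE connected base `B^temp(Π^tp_X)⁰`: second-half clause, print orientation, unconditional equivalence -/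

section Connected

variable {K : Type u₀} [Field K] {X : SemiGraphs.TemperedArithmeticGroup.{u₀} K} {D₀ : Type u₀} [Category.{v₀} D₀]
  {V : FrdIMonoidStub.{w}} {T₀ : RealifiedDivisorMonoids (D₀ := D₀) V}
  {VD : FrdICatStub.{u₀ + 1, u₀, w} (ConnectedPart (BTemp X.Pi))}
  {tf : TemperedFrobenioid T₀ (ConnectedPart (BTemp X.Pi)) VD} {hZ : tf.monoidType = MonoidType.Z}
  {hP : ∀ A : (ConnectedPart (BTemp X.Pi))ᵒᵖ, IsPerfect (tf.Φ.carrier A)}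
  {NH : Subgroup (Field.absoluteGaloisGroup K) → tf.category → ℕ+ → Prop} {A₀ : tf.category}
  {hA₀ : PreFrobenioid.IsFrobeniusTrivial tf.toElem A₀} {hA₀' : SemiGraphs.IsGaloisObj A₀.base.obj}
  {pullFrac : ∀ {A A' : (BiKummerSetting.mkOfConnectedTemperoid X tf hZ hP NH A₀ hA₀ hA₀').C} (_ : A' ⟶ A),
    (BiKummerSetting.mkOfConnectedTemperoid X tf hZ hP NH A₀ hA₀ hA₀').biratUnits A →
      (BiKummerSetting.mkOfConnectedTemperoid X tf hZ hP NH A₀ hA₀ hA₀').biratUnits A'}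
  {lv N : ℕ+} {T : ThetaEnvData.{max u₀ w} N}
  {θ : (BiKummerSetting.mkOfConnectedTemperoid X tf hZ hP NH A₀ hA₀ hA₀').biratUnits
    (BiKummerSetting.mkOfConnectedTemperoid X tf hZ hP NH A₀ hA₀ hA₀').Aodot}
  {Bl : (BiKummerSetting.mkOfConnectedTemperoid X tf hZ hP NH A₀ hA₀ hA₀').C}
  {Pl : (BiKummerSetting.mkOfConnectedTemperoid X tf hZ hP NH A₀ hA₀ hA₀').FractionPair θ Bl}
  {Rl : (BiKummerSetting.mkOfConnectedTemperoid X tf hZ hP NH A₀ hA₀ hA₀').NthRoot θ Pl lv pullFrac}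
  (h : ModelFrobenioid.Hypotheses tf.divisorMonoid tf.ratFnFunctor)
  (Q : FrobenioidTheta.ThetaSubquotientStub.{w} (ConnectedPart (BTemp X.Pi))) (odd_l : Odd (lv : ℕ))
  (R : (BiKummerSetting.mkOfConnectedTemperoid X tf hZ hP NH A₀ hA₀ hA₀').NthRoot Rl.root Rl.pair N pullFrac)
  (ιX : T.PiX ≃ₜ* X.Pi) (K' : Type w) [Field K'] (constEmb : K'ˣ →* tf.biratUnitsModel R.BN)
  (constEmb_injective : Function.Injective constEmb)
  (hinvc : ∀ g : Aut R.AN.base,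
    pull tf.divisorMonoid g.hom (ModelFrobenioid.div R.pair.num) = ModelFrobenioid.div R.pair.num)
  (hinvp : ∀ y : T.PiX, y ∈ T.PiYdd →
    pull tf.divisorMonoid ((BiKummerSetting.mkOfConnectedTemperoid X tf hZ hP NH A₀ hA₀ hA₀').galoisSurj R.AN.base
      R.αData.isGalois (ιX y)).hom (ModelFrobenioid.div R.pair.den) = ModelFrobenioid.div R.pair.den)

/-- Lemma 5.9 (i) over `B^temp(Π^tp_X)⁰`, SECOND-HALF clause alone: `s^⊔-gp_N(h) ∈ E_N` for every `h ∈ H_{B_N}` (mod `hH`).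
[cite: MochizukiEtTh2009, Lem 5.9 (i) p.331 (PDF p.105)] -/
theorem sgpCup_mem_EN_ofConnectedTemperoidData
    (hH : ∀ y : T.PiX, y ∈ T.PiYdd → ιX y ∈ (BiKummerSetting.mkOfConnectedTemperoid X tf hZ hP NH A₀ hA₀ hA₀').Hodot)
    (hh : (ofConnectedTemperoidData h Q odd_l R ιX K' constEmb constEmb_injective hinvc hinvp).HB) :
    (ofConnectedTemperoidData h Q odd_l R ιX K' constEmb constEmb_injective hinvc hinvp).sgpCup hh ∈
      (ofConnectedTemperoidData h Q odd_l R ιX K' constEmb constEmb_injective hinvc hinvp).EN :=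
  (sectionsFactor_ofConnectedTemperoidData h Q odd_l R ιX K' constEmb constEmb_injective hinvc hinvp hH).2 hh

/-- Prop. 4.3 (iii) over `B^temp(Π^tp_X)⁰` in PRINT's orientation (kurims p. 83 / PRIMS p. 317: "the difference
`s^⊓-gp_N · (s^⊔-gp_N)^{-1}` … `→ μ_N(B_N)`"): `s^⊓-gp_N(h) · s^⊔-gp_N(h)⁻¹ ∈ μ_N(B_N)` for every `h ∈ H_{B_N}` (mod `hH`).
[cite: MochizukiEtTh2009, Prop 4.3 (iii) p.317 (PDF p.91)] -/
theorem sgpCap_mul_sgpCup_inv_mem_muTorsion_ofConnectedTemperoidData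
    (hH : ∀ y : T.PiX, y ∈ T.PiYdd → ιX y ∈ (BiKummerSetting.mkOfConnectedTemperoid X tf hZ hP NH A₀ hA₀ hA₀').Hodot)
    (hh : (ofConnectedTemperoidData h Q odd_l R ιX K' constEmb constEmb_injective hinvc hinvp).HB) :
    (ofConnectedTemperoidData h Q odd_l R ιX K' constEmb constEmb_injective hinvc hinvp).sgpCap
        (hh : Aut ((ofConnectedTemperoidData h Q odd_l R ιX K' constEmb constEmb_injective hinvc hinvp).base.obj
          (ofConnectedTemperoidData h Q odd_l R ιX K' constEmb constEmb_injective hinvc hinvp).BN)) *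
      ((ofConnectedTemperoidData h Q odd_l R ιX K' constEmb constEmb_injective hinvc hinvp).sgpCup hh)⁻¹ ∈
      (ofConnectedTemperoidData h Q odd_l R ιX K' constEmb constEmb_injective hinvc hinvp).muTorsion
        (ofConnectedTemperoidData h Q odd_l R ιX K' constEmb constEmb_injective hinvc hinvp).BN
        (ofConnectedTemperoidData h Q odd_l R ιX K' constEmb constEmb_injective hinvc hinvp).N :=
  ((biKummerDifferenceMem_iff _).mp
    (biKummerDifferenceMem_ofConnectedTemperoidData h Q odd_l R ιX K' constEmb constEmb_injective hinvc hinvp hH)) hh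

/-- Over `B^temp(Π^tp_X)⁰` BOTH sections are sections over `H_{B_N}` outright (`sgpCapSection_ofConnectedTemperoidData`;
`sgpCupSection_ofBiKummerData` with `hσ := baseMap_strvOfBiKummerData`), so **Lemma 5.9 (i) ⟺ Prop. 4.3 (iii) holds there
with NO hypothesis** (`sectionsFactor_iff_biKummerDifferenceMem`).
[cite: MochizukiEtTh2009, Lem 5.9 (i) p.331 (PDF p.105); Prop 4.3 (iii) p.317 (PDF p.91)] -/
theorem sectionsFactor_iff_biKummerDifferenceMem_ofConnectedTemperoidData :
    (ofConnectedTemperoidData h Q odd_l R ιX K' constEmb constEmb_injective hinvc hinvp).SectionsFactor ↔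
      (ofConnectedTemperoidData h Q odd_l R ιX K' constEmb constEmb_injective hinvc hinvp).BiKummerDifferenceMem :=
  sectionsFactor_iff_biKummerDifferenceMem _
    (sgpCapSection_ofConnectedTemperoidData h Q odd_l R ιX K' constEmb constEmb_injective hinvc hinvp)
    (sgpCupSection_ofBiKummerData h _ Q odd_l R ιX _ _ K' constEmb constEmb_injective _ _ (baseMap_strvOfBiKummerData h R))

end Connected

/-! ### `A_⊙^bs := Ÿ` over `B^temp(Π^tp_X)⁰`: print orientation and the node package, NO named input -/

section Ydd

variable {K : Type u₀} [Field K] {X : SemiGraphs.TemperedArithmeticGroup.{u₀} K} {D₀ : Type u₀} [Category.{v₀} D₀]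
  {V : FrdIMonoidStub.{w}} {T₀ : RealifiedDivisorMonoids (D₀ := D₀) V}
  {VD : FrdICatStub.{u₀ + 1, u₀, w} (ConnectedPart (BTemp X.Pi))}
  {tf : TemperedFrobenioid T₀ (ConnectedPart (BTemp X.Pi)) VD} {hZ : tf.monoidType = MonoidType.Z}
  {hP : ∀ A : (ConnectedPart (BTemp X.Pi))ᵒᵖ, IsPerfect (tf.Φ.carrier A)}
  {NH : Subgroup (Field.absoluteGaloisGroup K) → tf.category → ℕ+ → Prop}
  {lv N : ℕ+} {T : ThetaEnvData.{max u₀ w} N} {ιX : T.PiX ≃ₜ* X.Pi}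
  {pullFrac : ∀ {A A' : (BiKummerSetting.mkOfConnectedTemperoidYdd X tf hZ hP NH T ιX).C} (_ : A' ⟶ A),
    (BiKummerSetting.mkOfConnectedTemperoidYdd X tf hZ hP NH T ιX).biratUnits A →
      (BiKummerSetting.mkOfConnectedTemperoidYdd X tf hZ hP NH T ιX).biratUnits A'}
  {θ : (BiKummerSetting.mkOfConnectedTemperoidYdd X tf hZ hP NH T ιX).biratUnits
    (BiKummerSetting.mkOfConnectedTemperoidYdd X tf hZ hP NH T ιX).Aodot}
  {Bl : (BiKummerSetting.mkOfConnectedTemperoidYdd X tf hZ hP NH T ιX).C}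
  {Pl : (BiKummerSetting.mkOfConnectedTemperoidYdd X tf hZ hP NH T ιX).FractionPair θ Bl}
  {Rl : (BiKummerSetting.mkOfConnectedTemperoidYdd X tf hZ hP NH T ιX).NthRoot θ Pl lv pullFrac}
  (h : ModelFrobenioid.Hypotheses tf.divisorMonoid tf.ratFnFunctor)
  (Q : FrobenioidTheta.ThetaSubquotientStub.{w} (ConnectedPart (BTemp X.Pi))) (odd_l : Odd (lv : ℕ))
  (R : (BiKummerSetting.mkOfConnectedTemperoidYdd X tf hZ hP NH T ιX).NthRoot Rl.root Rl.pair N pullFrac)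
  (K' : Type w) [Field K'] (constEmb : K'ˣ →* tf.biratUnitsModel R.BN) (constEmb_injective : Function.Injective constEmb)
  (hinvc : ∀ g : Aut R.AN.base,
    pull tf.divisorMonoid g.hom (ModelFrobenioid.div R.pair.num) = ModelFrobenioid.div R.pair.num)
  (hinvp : ∀ y : T.PiX, y ∈ T.PiYdd →
    pull tf.divisorMonoid ((BiKummerSetting.mkOfConnectedTemperoidYdd X tf hZ hP NH T ιX).galoisSurj R.AN.base
      R.αData.isGalois (ιX y)).hom (ModelFrobenioid.div R.pair.den) = ModelFrobenioid.div R.pair.den)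

/-- **Prop. 4.3 (iii) in PRINT's orientation at the genuine §5 data with `A_⊙^bs := Ÿ` — NO named input**:
`s^⊓-gp_N(h) · s^⊔-gp_N(h)⁻¹ ∈ μ_N(B_N)` for every `h ∈ H_{B_N}` (kurims p. 83 / PRIMS p. 317), from abc-iut-w6-d054's
`biKummerDifferenceMem_ofConnectedTemperoidYddData` (p433353). [cite: MochizukiEtTh2009, Prop 4.3 (iii) p.317 (PDF p.91)] -/
theorem sgpCap_mul_sgpCup_inv_mem_muTorsion_ofConnectedTemperoidYddData
    (hh : (ofConnectedTemperoidData h Q odd_l R ιX K' constEmb constEmb_injective hinvc hinvp).HB) :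
    (ofConnectedTemperoidData h Q odd_l R ιX K' constEmb constEmb_injective hinvc hinvp).sgpCap
        (hh : Aut ((ofConnectedTemperoidData h Q odd_l R ιX K' constEmb constEmb_injective hinvc hinvp).base.obj
          (ofConnectedTemperoidData h Q odd_l R ιX K' constEmb constEmb_injective hinvc hinvp).BN)) *
      ((ofConnectedTemperoidData h Q odd_l R ιX K' constEmb constEmb_injective hinvc hinvp).sgpCup hh)⁻¹ ∈
      (ofConnectedTemperoidData h Q odd_l R ιX K' constEmb constEmb_injective hinvc hinvp).muTorsion
        (ofConnectedTemperoidData h Q odd_l R ιX K' constEmb constEmb_injective hinvc hinvp).BN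
        (ofConnectedTemperoidData h Q odd_l R ιX K' constEmb constEmb_injective hinvc hinvp).N :=
  ((biKummerDifferenceMem_iff _).mp
    (biKummerDifferenceMem_ofConnectedTemperoidYddData h Q odd_l R K' constEmb constEmb_injective hinvc hinvp)) hh

/-- **Prop. 4.3 (iii) ∧ Lemma 5.9 (i) at the genuine §5 data (`A_⊙^bs := Ÿ`, base `B^temp(Π^tp_X)⁰`), unconditionally** —
the node certificate for `EtTh:Lem5.9(i)` at the genuine data together with its printed input (abc-iut-w6-d054's two theorems
of p433353, conjoined for the CERT-L2 conjunct shape).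
[cite: MochizukiEtTh2009, Lem 5.9 (i) p.331 (PDF p.105); Prop 4.3 (iii) p.317 (PDF p.91)] -/
theorem prop43iii_and_lem59i_ofConnectedTemperoidYddData :
    (ofConnectedTemperoidData h Q odd_l R ιX K' constEmb constEmb_injective hinvc hinvp).BiKummerDifferenceMem ∧
      (ofConnectedTemperoidData h Q odd_l R ιX K' constEmb constEmb_injective hinvc hinvp).SectionsFactor :=
  ⟨biKummerDifferenceMem_ofConnectedTemperoidYddData h Q odd_l R K' constEmb constEmb_injective hinvc hinvp,
    sectionsFactor_ofConnectedTemperoidYddData h Q odd_l R K' constEmb constEmb_injective hinvc hinvp⟩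

end Ydd

end ThetaFrobenioid

end Literature.AnabelianGeometry.EtaleTheta

end
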